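import Summits.CriticalPhenomena.PercolationContinuityZ3.Theorems.PercNearOneGluingNoHeavyLowerTailSahiSlotPairConeThresholdMiddle

/-!
# THE THRESHOLD-CYLINDER LIFTS: `Θ × [3] ∪ E × {2}` and `Θ × [3] ∪ E × {1,2}` for up-sets `E ⊇ Θ = {x : x_last ≥ 1}` —
# the first universal pivotal-pair certificates for single-axis chains with a NON-EMPTY BOTTOM slice, in every dimension

Support file of the one-cut programme (crux `NoHeavyLowerTail`, stmt-CriticalPhenomena-4575; cell `prim-masterthm`, seat P3, gen 24;
`run/shared/lean/prim/prim-masterthm/prim-masterthm-p3/HIERARCHY.md` §32(b''), memo `FROM-prim-masterthm-p3-g24-CERTIFICATE-RULES.md`).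

CO15XT.  Every universal lift theorem so far (`liftTwo`, `liftTop`, the top sandwich, the threshold-top sandwich, the threshold-middle
lift) concerns sets whose bottom slice along the lifted axis is EMPTY, and gen 24's LP censuses showed that a generic non-empty bottom slice
kills every typed certificate (families `(D,D,⊤)`, `(D,⊤,⊤)`, `(D,E,E)`, `(D,D,E)`, cylinders).  THIS FILE proves the two families with the
co-bottom THRESHOLD `Θ` as bottom slice: the chains `(Θ, Θ, E)` and `(Θ, E, E)` along the last axis, for every up-set `E ⊇ Θ` of `[3]^{n+1}`
and every `n` — equivalently `Θ_a ∪ (liftTop E₀ × [3]_a)` and `Θ_a ∪ (liftTwo E₀ × [3]_a)` for an arbitrary up-set `E₀ ⊆ [3]^n`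
(`E = E₀ × {0} ∪ [3]^n × {1,2}`).  Both identities were found by the instance-based universal-identity LP (joint over base dimensions
1, 2, 3; verified exactly one dimension up) and are proved here symbolically (27 level blocks, the base's last axis resolved, `ring`).
* `liftAll D = D × [3]` (cylinder along the last axis) and the full table `c_vals_all` of per-axis block counts;
* **`sStarD_thrCylTop_eq`**: `2·sStarD (Θ×[3] ∪ E×{2}) B C = 4·sStarD E B₂ C₂ + 3·sStarD Θ B₀ C₀ + 3·sStarD Θ B₁ C₁ + remCylTop E B C`,
  `remCylTop` = 13 explicit integer-weighted terms, each in `C ⊗ C` for an up-set `E` (`remCylTop_inPairCone`), hence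
  **`PinnedGood.thrCylTop : Θ ⊆ E → PinnedGood (n+1) E → PinnedGood (n+2) (thrCylTop E)`** (no up-set hypothesis on `E` is needed: no
  remainder term uses monotonicity of `E`);
* **`sStarD_thrCylTwo_eq`**: `sStarD (Θ×[3] ∪ E×{1,2}) B C = 2·sStarD E B₁ C₁ + 2·sStarD E B₂ C₂ + sStarD Θ B₀ C₀ + remCylTwo E B C`
  (15 terms), **`PinnedGood.thrCylTwo`**; value-level corollaries.
HONEST LABEL: certificate-format lift theorems in every dimension; no open cell changes status.  Pure, standard axioms. [this work]
-/

noncomputable section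

namespace Summit.CriticalPhenomena.PercolationContinuityZ3.Theorems

open Finset Function
open Literature.Combinatorics.Sahi2008

namespace SahiSlot

open SahiGridPattern SahiGrid3

variable {n : ℕ}

/-! ### The cylinder along the last axis and the full block table -/

/-- **The cylinder** `D × [3] ⊆ [3]^{n+1}` (last axis free). [this work] -/
def liftAll (D : Finset (Pd n)) : Finset (Pd (n + 1)) := univ.filter fun x => Fin.init x ∈ D

/-- Membership of a `snoc` point in the cylinder. [this work] -/
theorem snoc_mem_liftAll (D : Finset (Pd n)) (p : Pd n) (i : Fin 3) : (Fin.snoc p i : Pd (n + 1)) ∈ liftAll D ↔ p ∈ D := by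
  simp [liftAll, Fin.init_snoc]

/-- Every slice of the cylinder is the base. [this work] -/
theorem sl_liftAll (D : Finset (Pd n)) (j : Fin 3) : sl (liftAll D) j = D := by
  ext p; simp [sl, snoc_mem_liftAll]

/-- The cylinder over an up-set is an up-set. [this work] -/
theorem isUpperSet_liftAll {D : Finset (Pd n)} (hD : IsUpperSet (D : Set (Pd n))) :
    IsUpperSet ((liftAll D : Finset (Pd (n + 1))) : Set (Pd (n + 1))) := by
  intro x y hxy hx
  rw [Finset.mem_coe] at hx ⊢
  simp only [liftAll, Finset.mem_filter, Finset.mem_univ, true_and] at hx ⊢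
  exact hD (fun a => hxy (Fin.castSucc a)) hx

/-- The `c1` block counts for all 27 level blocks (bookkeeping). [this work] -/
theorem c1_vals_all :
    c1 (0:Fin 3) 0 0 = 2 ∧ c1 (0:Fin 3) 0 1 = 0 ∧ c1 (0:Fin 3) 0 2 = 0 ∧ c1 (0:Fin 3) 1 0 = 0 ∧ c1 (0:Fin 3) 1 1 = 0 ∧ c1 (0:Fin 3) 1 2 = 0 ∧
    c1 (0:Fin 3) 2 0 = 0 ∧ c1 (0:Fin 3) 2 1 = 0 ∧ c1 (0:Fin 3) 2 2 = 0 ∧ c1 (1:Fin 3) 0 0 = 0 ∧ c1 (1:Fin 3) 0 1 = 0 ∧ c1 (1:Fin 3) 0 2 = 0 ∧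
    c1 (1:Fin 3) 1 0 = 0 ∧ c1 (1:Fin 3) 1 1 = 2 ∧ c1 (1:Fin 3) 1 2 = 0 ∧ c1 (1:Fin 3) 2 0 = 0 ∧ c1 (1:Fin 3) 2 1 = 0 ∧ c1 (1:Fin 3) 2 2 = 0 ∧
    c1 (2:Fin 3) 0 0 = 0 ∧ c1 (2:Fin 3) 0 1 = 0 ∧ c1 (2:Fin 3) 0 2 = 0 ∧ c1 (2:Fin 3) 1 0 = 0 ∧ c1 (2:Fin 3) 1 1 = 0 ∧ c1 (2:Fin 3) 1 2 = 0 ∧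
    c1 (2:Fin 3) 2 0 = 0 ∧ c1 (2:Fin 3) 2 1 = 0 ∧ c1 (2:Fin 3) 2 2 = 2 := by
  unfold c1; decide

/-- The `c2` block counts for all 27 level blocks (bookkeeping). [this work] -/
theorem c2_vals_all :
    c2 (0:Fin 3) 0 0 = 0 ∧ c2 (0:Fin 3) 0 1 = 0 ∧ c2 (0:Fin 3) 0 2 = 0 ∧ c2 (0:Fin 3) 1 0 = 0 ∧ c2 (0:Fin 3) 1 1 = 1 ∧ c2 (0:Fin 3) 1 2 = 0 ∧
    c2 (0:Fin 3) 2 0 = 0 ∧ c2 (0:Fin 3) 2 1 = 0 ∧ c2 (0:Fin 3) 2 2 = 1 ∧ c2 (1:Fin 3) 0 0 = 1 ∧ c2 (1:Fin 3) 0 1 = 0 ∧ c2 (1:Fin 3) 0 2 = 0 ∧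
    c2 (1:Fin 3) 1 0 = 0 ∧ c2 (1:Fin 3) 1 1 = 0 ∧ c2 (1:Fin 3) 1 2 = 0 ∧ c2 (1:Fin 3) 2 0 = 0 ∧ c2 (1:Fin 3) 2 1 = 0 ∧ c2 (1:Fin 3) 2 2 = 1 ∧
    c2 (2:Fin 3) 0 0 = 1 ∧ c2 (2:Fin 3) 0 1 = 0 ∧ c2 (2:Fin 3) 0 2 = 0 ∧ c2 (2:Fin 3) 1 0 = 0 ∧ c2 (2:Fin 3) 1 1 = 1 ∧ c2 (2:Fin 3) 1 2 = 0 ∧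
    c2 (2:Fin 3) 2 0 = 0 ∧ c2 (2:Fin 3) 2 1 = 0 ∧ c2 (2:Fin 3) 2 2 = 0 := by
  unfold c2; decide

/-- The `c3` block counts for all 27 level blocks (bookkeeping). [this work] -/
theorem c3_vals_all :
    c3 (0:Fin 3) 0 0 = 0 ∧ c3 (0:Fin 3) 0 1 = 0 ∧ c3 (0:Fin 3) 0 2 = 0 ∧ c3 (0:Fin 3) 1 0 = 0 ∧ c3 (0:Fin 3) 1 1 = 0 ∧ c3 (0:Fin 3) 1 2 = 1 ∧
    c3 (0:Fin 3) 2 0 = 0 ∧ c3 (0:Fin 3) 2 1 = 1 ∧ c3 (0:Fin 3) 2 2 = 0 ∧ c3 (1:Fin 3) 0 0 = 0 ∧ c3 (1:Fin 3) 0 1 = 0 ∧ c3 (1:Fin 3) 0 2 = 1 ∧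
    c3 (1:Fin 3) 1 0 = 0 ∧ c3 (1:Fin 3) 1 1 = 0 ∧ c3 (1:Fin 3) 1 2 = 0 ∧ c3 (1:Fin 3) 2 0 = 1 ∧ c3 (1:Fin 3) 2 1 = 0 ∧ c3 (1:Fin 3) 2 2 = 0 ∧
    c3 (2:Fin 3) 0 0 = 0 ∧ c3 (2:Fin 3) 0 1 = 1 ∧ c3 (2:Fin 3) 0 2 = 0 ∧ c3 (2:Fin 3) 1 0 = 1 ∧ c3 (2:Fin 3) 1 1 = 0 ∧ c3 (2:Fin 3) 1 2 = 0 ∧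
    c3 (2:Fin 3) 2 0 = 0 ∧ c3 (2:Fin 3) 2 1 = 0 ∧ c3 (2:Fin 3) 2 2 = 0 := by
  unfold c3; decide

/-! ## THE THRESHOLD-CYLINDER-TOP LIFT `E ↦ Θ × [3] ∪ E × {2}` (slices `(Θ, Θ, E)`) -/

/-- **The threshold-cylinder-top set** `thrCylTop E = Θ × [3] ∪ E × {2} ⊆ [3]^{n+2}` (for `Θ ⊆ E`; slices `(Θ, Θ, E)`). [this work] -/
def thrCylTop (E : Finset (Pd (n + 1))) : Finset (Pd (n + 2)) := liftAll (Thr n) ∪ liftTop E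

/-- Bottom slice of the threshold-cylinder-top set is `Θ`. [this work] -/
theorem sl_thrCylTop_zero (E : Finset (Pd (n + 1))) : sl (thrCylTop E) 0 = Thr n := by
  ext p; simp [thrCylTop, sl, snoc_mem_liftAll, snoc_mem_liftTop]
/-- Middle slice of the threshold-cylinder-top set is `Θ`. [this work] -/
theorem sl_thrCylTop_one (E : Finset (Pd (n + 1))) : sl (thrCylTop E) 1 = Thr n := by
  ext p; simp [thrCylTop, sl, snoc_mem_liftAll, snoc_mem_liftTop]
/-- Top slice of the threshold-cylinder-top set is `E` (when `Θ ⊆ E`). [this work] -/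
theorem sl_thrCylTop_two {E : Finset (Pd (n + 1))} (hTE : Thr n ⊆ E) : sl (thrCylTop E) 2 = E := by
  have h : sl (thrCylTop E) 2 = Thr n ∪ E := by ext p; simp [thrCylTop, sl, snoc_mem_liftAll, snoc_mem_liftTop]
  rw [h]; exact Finset.union_eq_right.2 hTE
/-- The threshold-cylinder-top set of an up-set is an up-set. [this work] -/
theorem isUpperSet_thrCylTop {E : Finset (Pd (n + 1))} (hE : IsUpperSet (E : Set (Pd (n + 1)))) :
    IsUpperSet ((thrCylTop E : Finset (Pd (n + 2))) : Set (Pd (n + 2))) := by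
  unfold thrCylTop; rw [Finset.coe_union]
  exact (isUpperSet_liftAll (isUpperSet_Thr n)).union (isUpperSet_liftTop hE)

/-- The explicit remainder of the threshold-cylinder-top lift (13 terms, integer weights). [this work] -/
def remCylTop (E : Finset (Pd (n + 1))) (B C : Finset (Pd (n + 2))) : ℤ :=
  2 * Nf ((ind (sl C 2)) - (ind (sl C 1))) (ind (E \ Thr n)) (ind (sl B 2))
  + 2 * Nf ((ind (sl C 2)) - (ind (sl C 0))) (ind (E \ Thr n)) (ind (sl B 2))
  + 2 * Nf ((ind (sl B 2)) - (ind (sl B 1))) (ind (E \ Thr n)) (ind (sl C 2))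
  + 2 * Nf ((ind (sl B 2)) - (ind (sl B 0))) (ind (E \ Thr n)) (ind (sl C 2))
  + 2 * Lf (ind (univ \ E)) ((ind (sl B 1)) - (ind (sl B 0))) ((ind (sl C 1)) - (ind (sl C 0)))
  + 2 * Lf (ind (univ \ Thr n)) ((ind (sl B 1)) - (ind (sl B 0))) ((ind (sl C 1)) - (ind (sl C 0)))
  + 4 * Lf (ind (univ \ Thr n)) ((ind (sl B 2)) - (ind (sl B 1))) ((ind (sl C 2)) - (ind (sl C 1)))
  + 4 * Lf (ind (univ \ Thr n)) ((ind (sl B 2)) - (ind (sl B 0))) ((ind (sl C 2)) - (ind (sl C 0)))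
  + 4 * (Nf (ind (E \ Thr n)) (ind (sl B 2)) (ind (sl C 2)) - Lf (ind (E \ Thr n)) (ind (sl B 2)) (ind (sl C 2)))
  + 2 * (Nf (ind (univ \ E)) (ind (sl B 0)) (ind (sl C 0)) - Lf (ind (univ \ E)) (ind (sl B 0)) (ind (sl C 0)))
  + 2 * (Nf (ind (univ \ E)) (ind (sl B 1)) (ind (sl C 1)) - Lf (ind (univ \ E)) (ind (sl B 1)) (ind (sl C 1)))
  + (2 ^ (n + 1) * Dg (ind (Thr n)) (ind (sl B 0)) (ind (sl C 0)) - Nf (ind (Thr n)) (ind (sl B 0)) (ind (sl C 0)))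
  + (2 ^ (n + 1) * Dg (ind (Thr n)) (ind (sl B 1)) (ind (sl C 1)) - Nf (ind (Thr n)) (ind (sl B 1)) (ind (sl C 1)))

set_option maxHeartbeats 4000000 in
/-- **THE THRESHOLD-CYLINDER-TOP IDENTITY** (every `n`, all finsets `E ⊇ Θ`, `B`, `C`):
`2·sStarD (Θ×[3] ∪ E×{2}) B C = 4·sStarD E B₂ C₂ + 3·sStarD Θ B₀ C₀ + 3·sStarD Θ B₁ C₁ + remCylTop E B C`. [this work] -/
theorem sStarD_thrCylTop_eq {E : Finset (Pd (n + 1))} (hTE : Thr n ⊆ E) (B C : Finset (Pd (n + 2))) :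
    2 * sStarD (thrCylTop E) B C = 4 * sStarD E (sl B 2) (sl C 2) + 3 * sStarD (Thr n) (sl B 0) (sl C 0) + 3 * sStarD (Thr n) (sl B 1) (sl C 1) + remCylTop E B C := by
  have ss : ∀ f : Pd (n + 2) → ℤ, ∑ x, f x = ∑ i : Fin 3, ∑ p : Pd (n + 1), f (Fin.snoc p i) := fun f => sum_snoc f
  rw [sStarD_eq_sum_ind]
  simp only [ss, Fin.sum_univ_three, ind_sl, sl_thrCylTop_zero, sl_thrCylTop_one, sl_thrCylTop_two hTE, Finset.sum_add_distrib]
  rw [block_eq_atoms, block_eq_atoms, block_eq_atoms, block_eq_atoms, block_eq_atoms, block_eq_atoms, block_eq_atoms, block_eq_atoms, block_eq_atoms,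
    block_eq_atoms, block_eq_atoms, block_eq_atoms, block_eq_atoms, block_eq_atoms, block_eq_atoms, block_eq_atoms, block_eq_atoms, block_eq_atoms,
    block_eq_atoms, block_eq_atoms, block_eq_atoms, block_eq_atoms, block_eq_atoms, block_eq_atoms, block_eq_atoms, block_eq_atoms, block_eq_atoms]
  obtain ⟨a0, a1, a2, a3, a4, a5, a6, a7, a8, a9, a10, a11, a12, a13, a14, a15, a16, a17, a18, a19, a20, a21, a22, a23, a24, a25, a26⟩ := c1_vals_all
  obtain ⟨b0, b1, b2, b3, b4, b5, b6, b7, b8, b9, b10, b11, b12, b13, b14, b15, b16, b17, b18, b19, b20, b21, b22, b23, b24, b25, b26⟩ := c2_vals_all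
  obtain ⟨d0, d1, d2, d3, d4, d5, d6, d7, d8, d9, d10, d11, d12, d13, d14, d15, d16, d17, d18, d19, d20, d21, d22, d23, d24, d25, d26⟩ := c3_vals_all
  simp only [a0, a1, a2, a3, a4, a5, a6, a7, a8, a9, a10, a11, a12, a13, a14, a15, a16, a17, a18, a19, a20, a21, a22, a23, a24, a25, a26, b0, b1, b2, b3, b4, b5, b6, b7, b8, b9, b10, b11, b12, b13, b14, b15, b16, b17, b18, b19, b20, b21, b22, b23, b24, b25, b26, d0, d1, d2, d3, d4, d5, d6, d7, d8, d9, d10, d11, d12, d13, d14, d15, d16, d17, d18, d19, d20, d21, d22, d23, d24, d25, d26, zero_mul, one_mul, zero_sub, sub_zero, zero_add, add_zero]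
  rw [sStarD_counting_atoms, sStarD_counting_atoms, sStarD_counting_atoms]
  simp (maxSteps := 20000000) only [remCylTop, ind_sdiff_fun hTE, ind_univ_sdiff, Nf_sub₁, Nf_sub₂, Lf_sub₁, Lf_sub₂, Lf_sub₃]
  simp (maxSteps := 20000000) only [Dg_snoc3, Nf_snoc6, Lf_snoc6]
  simp (maxSteps := 20000000) only [fsl_ind, sl_one_of_Thr_subset hTE, sl_two_of_Thr_subset hTE, Thr, sl_liftTwo_zero, sl_liftTwo_one, sl_liftTwo_two, sl_univ_eq]
  simp (maxSteps := 20000000) only [ind_empty_fun, Dg_zero₁, Nf_zero₁, Nf_zero₂, Lf_zero₁, 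
    add_zero, zero_add]
  simp (maxSteps := 20000000) only [Nf_univ₁, Nf_univ₂]
  simp (maxSteps := 20000000) only [Lf_univ_comm (ind (sl (sl C 0) 0)) (ind (sl (sl B 0) 1)), Lf_univ_comm (ind (sl (sl C 0) 0)) (ind (sl (sl B 0) 2)), Lf_univ_comm (ind (sl (sl C 0) 0)) (ind (sl (sl B 1) 1)), Lf_univ_comm (ind (sl (sl C 0) 0)) (ind (sl (sl B 1) 2)), Lf_univ_comm (ind (sl (sl C 0) 0)) (ind (sl (sl B 2) 1)), Lf_univ_comm (ind (sl (sl C 0) 0)) (ind (sl (sl B 2) 2)), Lf_univ_comm (ind (sl (sl C 0) 1)) (ind (sl (sl B 0) 2)), Lf_univ_comm (ind (sl (sl C 0) 1)) (ind (sl (sl B 1) 2)), Lf_univ_comm (ind (sl (sl C 0) 1)) (ind (sl (sl B 2) 2)), Lf_univ_comm (ind (sl (sl C 0) 2)) (ind (sl (sl B 0) 1)), Lf_univ_comm (ind (sl (sl C 0) 2)) (ind (sl (sl B 1) 1)), Lf_univ_comm (ind (sl (sl C 0) 2)) (ind (sl (sl B 2) 1)), Lf_univ_comm (ind (sl (sl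 C 1) 0)) (ind (sl (sl B 0) 1)), Lf_univ_comm (ind (sl (sl C 1) 0)) (ind (sl (sl B 0) 2)), Lf_univ_comm (ind (sl (sl C 1) 0)) (ind (sl (sl B 1) 1)), Lf_univ_comm (ind (sl (sl C 1) 0)) (ind (sl (sl B 1) 2)), Lf_univ_comm (ind (sl (sl C 1) 0)) (ind (sl (sl B 2) 1)), Lf_univ_comm (ind (sl (sl C 1) 0)) (ind (sl (sl B 2) 2)), Lf_univ_comm (ind (sl (sl C 1) 1)) (ind (sl (sl B 0) 2)), Lf_univ_comm (ind (sl (sl C 1) 1)) (ind (sl (sl B 1) 2)), Lf_univ_comm (ind (sl (sl C 1) 1)) (ind (sl (sl B 2) 2)), Lf_univ_comm (ind (sl (sl C 1) 2)) (ind (sl (sl B 0) 1)), Lf_univ_comm (ind (sl (sl C 1) 2)) (ind (sl (sl B 1) 1)), Lf_univ_comm (ind (sl (sl C 1) 2)) (ind (sl (sl B 2) 1)), Lf_univ_comm (ind (sl (sl C 2) 0)) (ind (sl (sl B 0) 1)), Lf_univ_comm (ind (sl (sl C 2) 0)) (ind (sl (sl B 0) 2)), Lf_univ_comm (ind (sl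 (sl C 2) 0)) (ind (sl (sl B 1) 1)), Lf_univ_comm (ind (sl (sl C 2) 0)) (ind (sl (sl B 1) 2)), Lf_univ_comm (ind (sl (sl C 2) 0)) (ind (sl (sl B 2) 1)), Lf_univ_comm (ind (sl (sl C 2) 0)) (ind (sl (sl B 2) 2)), Lf_univ_comm (ind (sl (sl C 2) 1)) (ind (sl (sl B 0) 2)), Lf_univ_comm (ind (sl (sl C 2) 1)) (ind (sl (sl B 1) 2)), Lf_univ_comm (ind (sl (sl C 2) 1)) (ind (sl (sl B 2) 2)), Lf_univ_comm (ind (sl (sl C 2) 2)) (ind (sl (sl B 0) 1)), Lf_univ_comm (ind (sl (sl C 2) 2)) (ind (sl (sl B 1) 1)), Lf_univ_comm (ind (sl (sl C 2) 2)) (ind (sl (sl B 2) 1))]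
  ring
/-- **The threshold-cylinder-top remainder is in the pair cone** — for EVERY finset `E` (no term uses monotonicity of `E`). [this work] -/
theorem remCylTop_inPairCone (E : Finset (Pd (n + 1))) :
    InPairCone (n + 2) (fun B C => (remCylTop E B C : ℝ)) := by
  have h01 : (0 : Fin 3) ≤ 1 := by decide
  have h12 : (1 : Fin 3) ≤ 2 := by decide
  have h02 : (0 : Fin 3) ≤ 2 := by decide
  have e0 := ((inPairCone_VcP (E \ Thr n) h12 2)).smul (by norm_num : (0:ℝ) ≤ 2)
  have e1 := ((inPairCone_VcP (E \ Thr n) h02 2)).smul (by norm_num : (0:ℝ) ≤ 2)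
  have e2 := ((inPairCone_VbP (E \ Thr n) h12 2)).smul (by norm_num : (0:ℝ) ≤ 2)
  have e3 := ((inPairCone_VbP (E \ Thr n) h02 2)).smul (by norm_num : (0:ℝ) ≤ 2)
  have e4 := ((inPairCone_LfVV (univ \ E) h01 h01)).smul (by norm_num : (0:ℝ) ≤ 2)
  have e5 := ((inPairCone_LfVV (univ \ Thr n) h01 h01)).smul (by norm_num : (0:ℝ) ≤ 2)
  have e6 := ((inPairCone_LfVV (univ \ Thr n) h12 h12)).smul (by norm_num : (0:ℝ) ≤ 4)
  have e7 := ((inPairCone_LfVV (univ \ Thr n) h02 h02)).smul (by norm_num : (0:ℝ) ≤ 4)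
  have e8 := ((inPairCone_HF (E \ Thr n) 2 2)).smul (by norm_num : (0:ℝ) ≤ 4)
  have e9 := ((inPairCone_HF (univ \ E) 0 0)).smul (by norm_num : (0:ℝ) ≤ 2)
  have e10 := ((inPairCone_HF (univ \ E) 1 1)).smul (by norm_num : (0:ℝ) ≤ 2)
  have e11 := ((inPairCone_KD_thr (n := n) 0)).smul (by norm_num : (0:ℝ) ≤ 1)
  have e12 := ((inPairCone_KD_thr (n := n) 1)).smul (by norm_num : (0:ℝ) ≤ 1)
  refine (((((((((((((e0.add e1).add e2).add e3).add e4).add e5).add e6).add e7).add e8).add e9).add e10).add e11).add e12)).congr fun B C _ _ => ?_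
  simp only [remCylTop]
  push_cast
  ring

/-- **THE THRESHOLD-CYLINDER-TOP LIFT at the format level**: if `E ⊇ Θ` (any finset of `[3]^{n+1}`) has a pinned certificate, so does
`Θ × [3] ∪ E × {2} ⊆ [3]^{n+2}`. [this work] -/
theorem PinnedGood.thrCylTop {E : Finset (Pd (n + 1))} (hTE : Thr n ⊆ E) (h : PinnedGood (n + 1) E) : PinnedGood (n + 2) (thrCylTop E) := by
  have hT : PinnedGood (n + 1) (Thr n) := pinnedGood_threshold_one n
  have c2 : (0:ℝ) ≤ 1 / 2 := by norm_num
  refine ((((((h.slices 2 2).smul (by norm_num : (0:ℝ) ≤ 4)).add ((hT.slices 0 0).smul (by norm_num : (0:ℝ) ≤ 3))).add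
    ((hT.slices 1 1).smul (by norm_num : (0:ℝ) ≤ 3))).add (remCylTop_inPairCone E)).smul c2).congr fun B C _ _ => ?_
  have e := sStarD_thrCylTop_eq hTE B C
  have e' : (sStarD (SahiSlot.thrCylTop E) B C : ℝ) = (1 / 2) * (4 * (sStarD E (sl B 2) (sl C 2) : ℝ)
      + 3 * (sStarD (Thr n) (sl B 0) (sl C 0) : ℝ) + 3 * (sStarD (Thr n) (sl B 1) (sl C 1) : ℝ) + (remCylTop E B C : ℝ)) := by
    have := congrArg (fun z : ℤ => (z : ℝ)) e
    push_cast at this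
    linarith
  rw [e']

/-- VALUE-LEVEL corollary. [this work] -/
theorem sStarD_thrCylTop_nonneg {E : Finset (Pd (n + 1))} (hTE : Thr n ⊆ E) (h : PinnedGood (n + 1) E) (B C : Finset (Pd (n + 2))) (hB : IsUpperSet (B : Set (Pd (n + 2)))) (hC : IsUpperSet (C : Set (Pd (n + 2)))) :
    0 ≤ sStarD (thrCylTop E) B C :=
  (h.thrCylTop hTE).sStarD_nonneg B C hB hC

/-! ## THE THRESHOLD-CYLINDER-TWO LIFT `E ↦ Θ × [3] ∪ E × {1,2}` (slices `(Θ, E, E)`) -/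

/-- **The threshold-cylinder-two set** `thrCylTwo E = Θ × [3] ∪ E × {1,2} ⊆ [3]^{n+2}` (for `Θ ⊆ E`; slices `(Θ, E, E)`). [this work] -/
def thrCylTwo (E : Finset (Pd (n + 1))) : Finset (Pd (n + 2)) := liftAll (Thr n) ∪ liftTwo E

/-- Bottom slice of the threshold-cylinder-two set is `Θ`. [this work] -/
theorem sl_thrCylTwo_zero (E : Finset (Pd (n + 1))) : sl (thrCylTwo E) 0 = Thr n := by
  ext p; simp [thrCylTwo, sl, snoc_mem_liftAll, snoc_mem_liftTwo]
/-- Middle slice of the threshold-cylinder-two set is `E` (when `Θ ⊆ E`). [this work] -/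
theorem sl_thrCylTwo_one {E : Finset (Pd (n + 1))} (hTE : Thr n ⊆ E) : sl (thrCylTwo E) 1 = E := by
  have h : sl (thrCylTwo E) 1 = Thr n ∪ E := by ext p; simp [thrCylTwo, sl, snoc_mem_liftAll, snoc_mem_liftTwo]
  rw [h]; exact Finset.union_eq_right.2 hTE
/-- Top slice of the threshold-cylinder-two set is `E` (when `Θ ⊆ E`). [this work] -/
theorem sl_thrCylTwo_two {E : Finset (Pd (n + 1))} (hTE : Thr n ⊆ E) : sl (thrCylTwo E) 2 = E := by
  have h : sl (thrCylTwo E) 2 = Thr n ∪ E := by ext p; simp [thrCylTwo, sl, snoc_mem_liftAll, snoc_mem_liftTwo]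
  rw [h]; exact Finset.union_eq_right.2 hTE
/-- The threshold-cylinder-two set of an up-set is an up-set. [this work] -/
theorem isUpperSet_thrCylTwo {E : Finset (Pd (n + 1))} (hE : IsUpperSet (E : Set (Pd (n + 1)))) :
    IsUpperSet ((thrCylTwo E : Finset (Pd (n + 2))) : Set (Pd (n + 2))) := by
  unfold thrCylTwo; rw [Finset.coe_union]
  exact (isUpperSet_liftAll (isUpperSet_Thr n)).union (isUpperSet_liftTwo hE)

/-- The explicit remainder of the threshold-cylinder-two lift (15 terms, integer weights). [this work] -/
def remCylTwo (E : Finset (Pd (n + 1))) (B C : Finset (Pd (n + 2))) : ℤ :=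
  Nf ((ind (sl C 1)) - (ind (sl C 0))) (ind (E \ Thr n)) (ind (sl B 1))
  + Nf ((ind (sl C 2)) - (ind (sl C 0))) (ind (E \ Thr n)) (ind (sl B 2))
  + Nf ((ind (sl B 1)) - (ind (sl B 0))) (ind (E \ Thr n)) (ind (sl C 1))
  + Nf ((ind (sl C 2)) - (ind (sl C 1))) (ind (E \ Thr n)) ((ind (sl B 2)) - (ind (sl B 1)))
  + Nf ((ind (sl B 2)) - (ind (sl B 1))) (ind (E \ Thr n)) ((ind (sl C 2)) - (ind (sl C 1)))
  + Nf ((ind (sl B 2)) - (ind (sl B 0))) (ind (E \ Thr n)) (ind (sl C 2))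
  + Lf (ind (univ \ E)) ((ind (sl B 1)) - (ind (sl B 0))) ((ind (sl C 1)) - (ind (sl C 0)))
  + Lf (ind (univ \ E)) ((ind (sl B 2)) - (ind (sl B 0))) ((ind (sl C 2)) - (ind (sl C 0)))
  + Lf (ind (univ \ Thr n)) ((ind (sl B 1)) - (ind (sl B 0))) ((ind (sl C 1)) - (ind (sl C 0)))
  + 2 * Lf (ind (univ \ Thr n)) ((ind (sl B 2)) - (ind (sl B 1))) ((ind (sl C 2)) - (ind (sl C 1)))
  + Lf (ind (univ \ Thr n)) ((ind (sl B 2)) - (ind (sl B 0))) ((ind (sl C 2)) - (ind (sl C 0)))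
  + (Nf (ind (E \ Thr n)) (ind (sl B 1)) (ind (sl C 1)) - Lf (ind (E \ Thr n)) (ind (sl B 1)) (ind (sl C 1)))
  + (Nf (ind (E \ Thr n)) (ind (sl B 2)) (ind (sl C 2)) - Lf (ind (E \ Thr n)) (ind (sl B 2)) (ind (sl C 2)))
  + 2 * (Nf (ind (univ \ E)) (ind (sl B 0)) (ind (sl C 0)) - Lf (ind (univ \ E)) (ind (sl B 0)) (ind (sl C 0)))
  + (2 ^ (n + 1) * Dg (ind (Thr n)) (ind (sl B 0)) (ind (sl C 0)) - Nf (ind (Thr n)) (ind (sl B 0)) (ind (sl C 0)))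

set_option maxHeartbeats 4000000 in
/-- **THE THRESHOLD-CYLINDER-TWO IDENTITY** (every `n`, all finsets `E ⊇ Θ`, `B`, `C`):
`sStarD (Θ×[3] ∪ E×{1,2}) B C = 2·sStarD E B₁ C₁ + 2·sStarD E B₂ C₂ + sStarD Θ B₀ C₀ + remCylTwo E B C`. [this work] -/
theorem sStarD_thrCylTwo_eq {E : Finset (Pd (n + 1))} (hTE : Thr n ⊆ E) (B C : Finset (Pd (n + 2))) :
    sStarD (thrCylTwo E) B C = 2 * sStarD E (sl B 1) (sl C 1) + 2 * sStarD E (sl B 2) (sl C 2) + sStarD (Thr n) (sl B 0) (sl C 0) + remCylTwo E B C := by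
  have ss : ∀ f : Pd (n + 2) → ℤ, ∑ x, f x = ∑ i : Fin 3, ∑ p : Pd (n + 1), f (Fin.snoc p i) := fun f => sum_snoc f
  rw [sStarD_eq_sum_ind]
  simp only [ss, Fin.sum_univ_three, ind_sl, sl_thrCylTwo_zero, sl_thrCylTwo_one hTE, sl_thrCylTwo_two hTE, Finset.sum_add_distrib]
  rw [block_eq_atoms, block_eq_atoms, block_eq_atoms, block_eq_atoms, block_eq_atoms, block_eq_atoms, block_eq_atoms, block_eq_atoms, block_eq_atoms,
    block_eq_atoms, block_eq_atoms, block_eq_atoms, block_eq_atoms, block_eq_atoms, block_eq_atoms, block_eq_atoms, block_eq_atoms, block_eq_atoms,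
    block_eq_atoms, block_eq_atoms, block_eq_atoms, block_eq_atoms, block_eq_atoms, block_eq_atoms, block_eq_atoms, block_eq_atoms, block_eq_atoms]
  obtain ⟨a0, a1, a2, a3, a4, a5, a6, a7, a8, a9, a10, a11, a12, a13, a14, a15, a16, a17, a18, a19, a20, a21, a22, a23, a24, a25, a26⟩ := c1_vals_all
  obtain ⟨b0, b1, b2, b3, b4, b5, b6, b7, b8, b9, b10, b11, b12, b13, b14, b15, b16, b17, b18, b19, b20, b21, b22, b23, b24, b25, b26⟩ := c2_vals_all
  obtain ⟨d0, d1, d2, d3, d4, d5, d6, d7, d8, d9, d10, d11, d12, d13, d14, d15, d16, d17, d18, d19, d20, d21, d22, d23, d24, d25, d26⟩ := c3_vals_all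
  simp only [a0, a1, a2, a3, a4, a5, a6, a7, a8, a9, a10, a11, a12, a13, a14, a15, a16, a17, a18, a19, a20, a21, a22, a23, a24, a25, a26, b0, b1, b2, b3, b4, b5, b6, b7, b8, b9, b10, b11, b12, b13, b14, b15, b16, b17, b18, b19, b20, b21, b22, b23, b24, b25, b26, d0, d1, d2, d3, d4, d5, d6, d7, d8, d9, d10, d11, d12, d13, d14, d15, d16, d17, d18, d19, d20, d21, d22, d23, d24, d25, d26, zero_mul, one_mul, zero_sub, sub_zero, zero_add, add_zero]
  rw [sStarD_counting_atoms, sStarD_counting_atoms, sStarD_counting_atoms]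
  simp (maxSteps := 20000000) only [remCylTwo, ind_sdiff_fun hTE, ind_univ_sdiff, Nf_sub₁, Nf_sub₂, Nf_sub₃, Lf_sub₁, Lf_sub₂, Lf_sub₃]
  simp (maxSteps := 20000000) only [Dg_snoc3, Nf_snoc6, Lf_snoc6]
  simp (maxSteps := 20000000) only [fsl_ind, sl_one_of_Thr_subset hTE, sl_two_of_Thr_subset hTE, Thr, sl_liftTwo_zero, sl_liftTwo_one, sl_liftTwo_two, sl_univ_eq]
  simp (maxSteps := 20000000) only [ind_empty_fun, Dg_zero₁, Nf_zero₁, Nf_zero₂, Lf_zero₁, 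
    add_zero, zero_add]
  simp (maxSteps := 20000000) only [Nf_univ₁, Nf_univ₂]
  simp (maxSteps := 20000000) only [Lf_univ_comm (ind (sl (sl C 0) 0)) (ind (sl (sl B 0) 1)), Lf_univ_comm (ind (sl (sl C 0) 0)) (ind (sl (sl B 0) 2)), Lf_univ_comm (ind (sl (sl C 0) 0)) (ind (sl (sl B 1) 1)), Lf_univ_comm (ind (sl (sl C 0) 0)) (ind (sl (sl B 1) 2)), Lf_univ_comm (ind (sl (sl C 0) 0)) (ind (sl (sl B 2) 1)), Lf_univ_comm (ind (sl (sl C 0) 0)) (ind (sl (sl B 2) 2)), Lf_univ_comm (ind (sl (sl C 0) 1)) (ind (sl (sl B 0) 2)), Lf_univ_comm (ind (sl (sl C 0) 1)) (ind (sl (sl B 1) 2)), Lf_univ_comm (ind (sl (sl C 0) 1)) (ind (sl (sl B 2) 2)), Lf_univ_comm (ind (sl (sl C 0) 2)) (ind (sl (sl B 0) 1)), Lf_univ_comm (ind (sl (sl C 0) 2)) (ind (sl (sl B 1) 1)), Lf_univ_comm (ind (sl (sl C 0) 2)) (ind (sl (sl B 2) 1)), Lf_univ_comm (ind (sl (sl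 C 1) 0)) (ind (sl (sl B 0) 1)), Lf_univ_comm (ind (sl (sl C 1) 0)) (ind (sl (sl B 0) 2)), Lf_univ_comm (ind (sl (sl C 1) 0)) (ind (sl (sl B 1) 1)), Lf_univ_comm (ind (sl (sl C 1) 0)) (ind (sl (sl B 1) 2)), Lf_univ_comm (ind (sl (sl C 1) 0)) (ind (sl (sl B 2) 1)), Lf_univ_comm (ind (sl (sl C 1) 0)) (ind (sl (sl B 2) 2)), Lf_univ_comm (ind (sl (sl C 1) 1)) (ind (sl (sl B 0) 2)), Lf_univ_comm (ind (sl (sl C 1) 1)) (ind (sl (sl B 1) 2)), Lf_univ_comm (ind (sl (sl C 1) 1)) (ind (sl (sl B 2) 2)), Lf_univ_comm (ind (sl (sl C 1) 2)) (ind (sl (sl B 0) 1)), Lf_univ_comm (ind (sl (sl C 1) 2)) (ind (sl (sl B 1) 1)), Lf_univ_comm (ind (sl (sl C 1) 2)) (ind (sl (sl B 2) 1)), Lf_univ_comm (ind (sl (sl C 2) 0)) (ind (sl (sl B 0) 1)), Lf_univ_comm (ind (sl (sl C 2) 0)) (ind (sl (sl B 0) 2)), Lf_univ_comm (ind (sl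 (sl C 2) 0)) (ind (sl (sl B 1) 1)), Lf_univ_comm (ind (sl (sl C 2) 0)) (ind (sl (sl B 1) 2)), Lf_univ_comm (ind (sl (sl C 2) 0)) (ind (sl (sl B 2) 1)), Lf_univ_comm (ind (sl (sl C 2) 0)) (ind (sl (sl B 2) 2)), Lf_univ_comm (ind (sl (sl C 2) 1)) (ind (sl (sl B 0) 2)), Lf_univ_comm (ind (sl (sl C 2) 1)) (ind (sl (sl B 1) 2)), Lf_univ_comm (ind (sl (sl C 2) 1)) (ind (sl (sl B 2) 2)), Lf_univ_comm (ind (sl (sl C 2) 2)) (ind (sl (sl B 0) 1)), Lf_univ_comm (ind (sl (sl C 2) 2)) (ind (sl (sl B 1) 1)), Lf_univ_comm (ind (sl (sl C 2) 2)) (ind (sl (sl B 2) 1))]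
  ring
/-- **The threshold-cylinder-two remainder is in the pair cone** — for EVERY finset `E`. [this work] -/
theorem remCylTwo_inPairCone (E : Finset (Pd (n + 1))) :
    InPairCone (n + 2) (fun B C => (remCylTwo E B C : ℝ)) := by
  have h01 : (0 : Fin 3) ≤ 1 := by decide
  have h12 : (1 : Fin 3) ≤ 2 := by decide
  have h02 : (0 : Fin 3) ≤ 2 := by decide
  have e0 := ((inPairCone_VcP (E \ Thr n) h01 1)).smul (by norm_num : (0:ℝ) ≤ 1)
  have e1 := ((inPairCone_VcP (E \ Thr n) h02 2)).smul (by norm_num : (0:ℝ) ≤ 1)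
  have e2 := ((inPairCone_VbP (E \ Thr n) h01 1)).smul (by norm_num : (0:ℝ) ≤ 1)
  have e3 := ((inPairCone_VVc (E \ Thr n) h12 h12)).smul (by norm_num : (0:ℝ) ≤ 1)
  have e4 := ((inPairCone_VVb (E \ Thr n) h12 h12)).smul (by norm_num : (0:ℝ) ≤ 1)
  have e5 := ((inPairCone_VbP (E \ Thr n) h02 2)).smul (by norm_num : (0:ℝ) ≤ 1)
  have e6 := ((inPairCone_LfVV (univ \ E) h01 h01)).smul (by norm_num : (0:ℝ) ≤ 1)
  have e7 := ((inPairCone_LfVV (univ \ E) h02 h02)).smul (by norm_num : (0:ℝ) ≤ 1)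
  have e8 := ((inPairCone_LfVV (univ \ Thr n) h01 h01)).smul (by norm_num : (0:ℝ) ≤ 1)
  have e9 := ((inPairCone_LfVV (univ \ Thr n) h12 h12)).smul (by norm_num : (0:ℝ) ≤ 2)
  have e10 := ((inPairCone_LfVV (univ \ Thr n) h02 h02)).smul (by norm_num : (0:ℝ) ≤ 1)
  have e11 := ((inPairCone_HF (E \ Thr n) 1 1)).smul (by norm_num : (0:ℝ) ≤ 1)
  have e12 := ((inPairCone_HF (E \ Thr n) 2 2)).smul (by norm_num : (0:ℝ) ≤ 1)
  have e13 := ((inPairCone_HF (univ \ E) 0 0)).smul (by norm_num : (0:ℝ) ≤ 2)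
  have e14 := ((inPairCone_KD_thr (n := n) 0)).smul (by norm_num : (0:ℝ) ≤ 1)
  refine (((((((((((((((e0.add e1).add e2).add e3).add e4).add e5).add e6).add e7).add e8).add e9).add e10).add e11).add e12).add e13).add e14)).congr fun B C _ _ => ?_
  simp only [remCylTwo]
  push_cast
  ring

/-- **THE THRESHOLD-CYLINDER-TWO LIFT at the format level**: if `E ⊇ Θ` (any finset of `[3]^{n+1}`) has a pinned certificate, so does
`Θ × [3] ∪ E × {1,2} ⊆ [3]^{n+2}`. [this work] -/
theorem PinnedGood.thrCylTwo {E : Finset (Pd (n + 1))} (hTE : Thr n ⊆ E) (h : PinnedGood (n + 1) E) : PinnedGood (n + 2) (thrCylTwo E) := by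
  have hT : PinnedGood (n + 1) (Thr n) := pinnedGood_threshold_one n
  refine (((((h.slices 1 1).smul (by norm_num : (0:ℝ) ≤ 2)).add ((h.slices 2 2).smul (by norm_num : (0:ℝ) ≤ 2))).add
    ((hT.slices 0 0).smul (by norm_num : (0:ℝ) ≤ 1))).add (remCylTwo_inPairCone E)).congr fun B C _ _ => ?_
  have e := sStarD_thrCylTwo_eq hTE B C
  have e' : (sStarD (SahiSlot.thrCylTwo E) B C : ℝ) = 2 * (sStarD E (sl B 1) (sl C 1) : ℝ) + 2 * (sStarD E (sl B 2) (sl C 2) : ℝ)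
      + 1 * (sStarD (Thr n) (sl B 0) (sl C 0) : ℝ) + (remCylTwo E B C : ℝ) := by
    have := congrArg (fun z : ℤ => (z : ℝ)) e
    push_cast at this
    linarith
  rw [e']

/-- VALUE-LEVEL corollary. [this work] -/
theorem sStarD_thrCylTwo_nonneg {E : Finset (Pd (n + 1))} (hTE : Thr n ⊆ E) (h : PinnedGood (n + 1) E) (B C : Finset (Pd (n + 2))) (hB : IsUpperSet (B : Set (Pd (n + 2)))) (hC : IsUpperSet (C : Set (Pd (n + 2)))) :
    0 ≤ sStarD (thrCylTwo E) B C :=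
  (h.thrCylTwo hTE).sStarD_nonneg B C hB hC

end SahiSlot

end Summit.CriticalPhenomena.PercolationContinuityZ3.Theorems
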